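import Literature.NumberTheory.CubicFields.MaximalRingCount
import Literature.NumberTheory.CubicFields.ShintaniZeta
import Literature.NumberTheory.CubicFields.StabilizerOneOrThree
import Literature.NumberTheory.CubicFields.CubeStabilizer
import HarnessLib

/-!
# `N^±_{≤3}(X) = #{|Aut| = 1} + ⅓ #{|Aut| = 3} + ½ N₂^±(X) + ⅙ [ℚ³]`: the bookkeeping behind BTT Prop. 4.3

Topic `Literature/NumberTheory/CubicFields`; the junction of `MaximalRingCount.lean` (maximal orbits
in a window = Davenport–Heilbronn orbits ⊔ maximal reducible orbits, counted by `N₃^±`, `N₂^±`),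
`ShintaniZeta.lean` (`stabCard`, an orbit invariant) and the table (29): `StabilizerOneOrThree`
(`|Stab| ∈ {1, 3}` for irreducible forms), `ShintaniZeta.stabCard_reducibleNormalForm_eq_two`
(`= 2` for `ℤ × 𝓞_F`), `CubeStabilizer` (`= 6` for `ℤ³`).

Bhargava–Taniguchi–Thorne 2023, §4.1 (28): `N^±_{≤3}(X) := Σ_{0 < ±Disc(F) < X} |Aut(F)|⁻¹` over
cubic étale algebras `F`, "in bijection with … maximal orders" whose automorphism groups are the
same; and Prop. 4.3: `N₃^±(X) = N^±_{≤3}(X) − ½ N₂^±(X) + O(X^{1/2})`, "immediate from Lemma 4.1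
(Cohn: `≪ X^{1/2}` Galois cubic fields) and the formula (29)". This file proves the exact identity
of which Prop. 4.3 is the consequence:

* `orbitWeight O = 1/|Stab(O)|`, `weightedMaximalCount s X = N^±_{≤3}(X)` — the sum of the weights
  of the maximal orbits with `0 < s · Disc < X`;
* `dhOrbitsOne`, `dhOrbitsThree` — the Davenport–Heilbronn orbits of weight `1` and `1/3` (the
  non-Galois and the Galois cubic fields, `MaximalStabilizer`), `card_dhOrbitsOne_add = N₃^±(X)`;
* **`weightedMaximalCount_neg`**: `N⁻_{≤3}(X) = #dhOrbitsOne + ⅓ #dhOrbitsThree + ½ #negFundDiscrs X`;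
* **`weightedMaximalCount_pos`**: `N⁺_{≤3}(X) = #dhOrbitsOne + ⅓ #dhOrbitsThree + ½ #posFundDiscrs X + ⅙ [1 < X]`.

So `N₃^± = #dhOrbitsOne + #dhOrbitsThree = N^±_{≤3} − ½ N₂^± − ⅙[…] + ⅔ #dhOrbitsThree`, and Prop. 4.3
is this identity plus Cohn's bound `#dhOrbitsThree ≪ X^{1/2}` (not formalized here).

## References

* M. Bhargava, T. Taniguchi, F. Thorne, *Improved error estimates for the Davenport–Heilbronn
  theorems*, Math. Ann. 389 (2024) = arXiv:2107.12819, §4.1 (28), (29), Prop. 4.3 [BhargavaTaniguchiThorne2023].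
-/

namespace Literature.NumberTheory.CubicFields

open BinaryCubic RingOfForm Finset Literature.NumberTheory.QuadraticFields

/-! ### The weight `1/|Stab|` of an orbit -/

open Classical in
/-- The weight `1/|Stab(O)|` of a `GL₂(ℤ)`-orbit `O` (and `0` on non-orbits). [cite: BhargavaTaniguchiThorne2023, §4.1 (28) (the weights |Aut(F)|⁻¹ = |Aut(R)|⁻¹)] -/
noncomputable def orbitWeight (O : Set (BinaryCubic ℤ)) : ℚ :=
  if h : ∃ g : BinaryCubic ℤ, O = gl2zOrbit g then ((stabCard h.choose : ℚ))⁻¹ else 0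

/-- The sign `s = -1` is admissible. [folklore] -/
instance instFactSignNegOne : Fact ((-1 : ℤ) = 1 ∨ (-1 : ℤ) = -1) := ⟨Or.inr rfl⟩

/-- The sign `s = 1` is admissible. [folklore] -/
instance instFactSignOne : Fact ((1 : ℤ) = 1 ∨ (1 : ℤ) = -1) := ⟨Or.inl rfl⟩

/-- The weight of the orbit of `g` is `1/|Stab(g)|`. [folklore] -/
theorem orbitWeight_gl2zOrbit (g : BinaryCubic ℤ) : orbitWeight (gl2zOrbit g) = ((stabCard g : ℚ))⁻¹ := by
  classical
  have h : ∃ g' : BinaryCubic ℤ, gl2zOrbit g = gl2zOrbit g' := ⟨g, rfl⟩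
  rw [orbitWeight, dif_pos h, stabCard_eq_of_gl2zEquiv (gl2zOrbit_eq_iff.mp h.choose_spec).symm]

/-- **`N^±_{≤3}(X)`** (BTT (28)): the sum of the weights `1/|Stab| = 1/|Aut|` over the maximal orbits
(= cubic étale algebras through their maximal orders) with `0 < s · Disc < X`. [cite: BhargavaTaniguchiThorne2023, §4.1 (28) (N^±_{≤3}(X))] -/
noncomputable def weightedMaximalCount (s : ℤ) [Fact (s = 1 ∨ s = -1)] (X : ℕ) : ℚ :=
  ∑ O ∈ (maximalOrbitsIn_finite s X).toFinset, orbitWeight O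

/-! ### The Davenport–Heilbronn part: weights `1` and `1/3` -/

variable (s : ℤ) [hs : Fact (s = 1 ∨ s = -1)] (X : ℕ)

/-- The Davenport–Heilbronn orbits of weight `1` (the non-Galois cubic fields, `MaximalStabilizer`). [folklore] -/
noncomputable def dhOrbitsOne : Finset (Set (BinaryCubic ℤ)) :=
  (dhOrbits_finite s (X : ℝ)).toFinset.filter fun O => orbitWeight O = 1

/-- The Davenport–Heilbronn orbits of weight `1/3` (the Galois cubic fields). [folklore] -/
noncomputable def dhOrbitsThree : Finset (Set (BinaryCubic ℤ)) :=
  (dhOrbits_finite s (X : ℝ)).toFinset.filter fun O => orbitWeight O = 3⁻¹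

omit hs in
/-- A Davenport–Heilbronn orbit has weight `1` or `1/3` (`|Stab| ∈ {1, 3}` for irreducible forms). [folklore] -/
theorem orbitWeight_of_mem_dhOrbits {O : Set (BinaryCubic ℤ)} (hO : O ∈ dhOrbits s (X : ℝ)) :
    orbitWeight O = 1 ∨ orbitWeight O = 3⁻¹ := by
  obtain ⟨f, rfl, hirr, -, -, -⟩ := hO
  haveI : Fact f.IsIrreducible := ⟨hirr⟩
  rw [orbitWeight_gl2zOrbit]
  rcases card_stabilizer_eq_one_or_three (f := f) with h | h
  · left; rw [stabCard, h]; norm_num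
  · right; rw [stabCard, h]; norm_num

/-- `#dhOrbitsOne + #dhOrbitsThree = N₃^±(X)`. [folklore] -/
theorem card_dhOrbitsOne_add : ((dhOrbitsOne s X).card : ℕ) + (dhOrbitsThree s X).card = cubicFieldCount s (X : ℝ) := by
  classical
  have h3 : dhOrbitsThree s X = (dhOrbits_finite s (X : ℝ)).toFinset.filter fun O => ¬ orbitWeight O = 1 := by
    unfold dhOrbitsThree
    apply Finset.filter_congr
    intro O hO
    rw [Set.Finite.mem_toFinset] at hO
    rcases orbitWeight_of_mem_dhOrbits s X hO with h | h
    · rw [h]; norm_num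
    · rw [h]; norm_num
  rw [dhOrbitsOne, h3, Finset.card_filter_add_card_filter_not, cubicFieldCount_eq_card_dhOrbits,
    Nat.card_eq_card_finite_toFinset (dhOrbits_finite s (X : ℝ))]

/-- The Davenport–Heilbronn part of `N_{≤3}`: `Σ_{DH orbits} weight = #dhOrbitsOne + ⅓ #dhOrbitsThree`. [folklore] -/
theorem sum_orbitWeight_dhOrbits :
    ∑ O ∈ (dhOrbits_finite s (X : ℝ)).toFinset, orbitWeight O = ((dhOrbitsOne s X).card : ℚ) + 3⁻¹ * ((dhOrbitsThree s X).card : ℚ) := by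
  classical
  rw [← Finset.sum_filter_add_sum_filter_not _ (fun O => orbitWeight O = 1)]
  have h1 : ∑ O ∈ (dhOrbits_finite s (X : ℝ)).toFinset.filter (fun O => orbitWeight O = 1), orbitWeight O = (dhOrbitsOne s X).card := by
    rw [dhOrbitsOne, Finset.card_eq_sum_ones, Nat.cast_sum, Nat.cast_one]
    exact Finset.sum_congr rfl fun O hO => (Finset.mem_filter.mp hO).2
  have h3 : ∑ O ∈ (dhOrbits_finite s (X : ℝ)).toFinset.filter (fun O => ¬ orbitWeight O = 1), orbitWeight O = 3⁻¹ * (dhOrbitsThree s X).card := by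
    have hset : (dhOrbits_finite s (X : ℝ)).toFinset.filter (fun O => ¬ orbitWeight O = 1) = dhOrbitsThree s X := by
      unfold dhOrbitsThree
      apply Finset.filter_congr
      intro O hO
      rw [Set.Finite.mem_toFinset] at hO
      rcases orbitWeight_of_mem_dhOrbits s X hO with h | h
      · rw [h]; norm_num
      · rw [h]; norm_num
    rw [hset, Finset.card_eq_sum_ones, Nat.cast_sum, Finset.mul_sum]
    refine Finset.sum_congr rfl fun O hO => ?_
    rw [(Finset.mem_filter.mp hO).2]; norm_num
  rw [h1, h3]

/-! ### The reducible part: weights `1/2` (`ℤ × 𝓞_F`) and `1/6` (`ℤ³`) -/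

/-- `f₀ = uv(u+v)` is reducible and maximal (the maximal order `ℤ³`). [folklore] -/
theorem cubeForm_reducible_isMaximal : ¬ cubeForm.IsIrreducible ∧ IsMaximal cubeForm := by
  refine ⟨fun h => h.1 rfl, ?_⟩
  rw [cubeForm, isMaximal_reducibleNormalForm_iff]
  right; norm_num

omit hs in
/-- **The weight of a maximal reducible orbit**: `1/6` for the orbit of `ℤ³` (`Disc = 1`), `1/2`
otherwise (`ℤ × 𝓞_F`, fundamental discriminant). [folklore] -/
theorem orbitWeight_of_mem_reducible {O : Set (BinaryCubic ℤ)} (hO : O ∈ reducibleMaximalOrbitsIn s X) :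
    (O = gl2zOrbit cubeForm ∧ orbitWeight O = 6⁻¹) ∨ (O ≠ gl2zOrbit cubeForm ∧ orbitWeight O = 2⁻¹) := by
  obtain ⟨g, rfl, hmax, hred, hlo, -⟩ := hO
  have hg0 : g.disc ≠ 0 := by rintro h; rw [h, mul_zero] at hlo; exact lt_irrefl _ hlo
  rcases isFundamental_disc_of_isMaximal hmax hred hg0 with hfund | h1
  · -- fundamental discriminant: normal form `(0,1,c,d)` with `c² − 4d = Disc g` fundamental, weight `1/2`
    right
    obtain ⟨c, d, -, hge⟩ := exists_normalForm_of_isMaximal hmax hred hg0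
    have hdisc : c ^ 2 - 4 * d = g.disc := by rw [← disc_reducibleNormalForm c d]; exact hge.disc_eq
    refine ⟨fun heq => ?_, ?_⟩
    · -- the orbit of `ℤ³` has `Disc = 1`, not fundamental
      have h1 : g.disc = 1 := by
        rw [← disc_cubeForm]; exact ((gl2zOrbit_eq_iff.mp heq).disc_eq).symm
      rw [h1] at hfund
      rcases hfund with ⟨-, -, hne⟩ | ⟨h4, -, -⟩
      · exact hne rfl
      · norm_num at h4
    · rw [orbitWeight_gl2zOrbit, stabCard_eq_of_gl2zEquiv hge]
      rw [← hdisc] at hfund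
      rw [stabCard_reducibleNormalForm_eq_two hfund]; norm_num
  · -- `Disc = 1`: the orbit of `ℤ³`, weight `1/6`
    left
    have hequiv : GL2ZEquiv g cubeForm :=
      gl2zEquiv_of_isMaximal_of_disc_eq hmax hred cubeForm_reducible_isMaximal.2 cubeForm_reducible_isMaximal.1 hg0
        (by rw [h1, disc_cubeForm])
    refine ⟨gl2zOrbit_eq_iff.mpr hequiv, ?_⟩
    rw [orbitWeight_gl2zOrbit, stabCard_eq_of_gl2zEquiv hequiv, stabCard, card_stabilizer_cubeForm]; norm_num

/-- The orbit of `ℤ³` lies in the window iff `s = 1` and `1 < X` (`Disc ℤ³ = 1`). [folklore] -/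
theorem cubeOrbit_mem_reducible_iff : gl2zOrbit cubeForm ∈ reducibleMaximalOrbitsIn s X ↔ s = 1 ∧ 1 < X := by
  constructor
  · rintro ⟨g, hO, -, -, hlo, hhi⟩
    have hd : g.disc = 1 := by rw [← disc_cubeForm]; exact ((gl2zOrbit_eq_iff.mp hO).disc_eq)
    rw [hd, mul_one] at hlo hhi
    rcases hs.out with rfl | rfl
    · exact ⟨rfl, by exact_mod_cast hhi⟩
    · norm_num at hlo
  · rintro ⟨rfl, hX⟩
    refine ⟨cubeForm, rfl, cubeForm_reducible_isMaximal.2, cubeForm_reducible_isMaximal.1, ?_, ?_⟩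
    · rw [disc_cubeForm]; norm_num
    · rw [disc_cubeForm]; exact_mod_cast hX

/-- The reducible part of `N_{≤3}`: `Σ_{maximal reducible orbits} weight = ½ #orbits − ⅓ [ℤ³ in the window]`. [folklore] -/
theorem sum_orbitWeight_reducible :
    ∑ O ∈ (reducibleMaximalOrbitsIn_finite s X).toFinset, orbitWeight O =
      2⁻¹ * (Nat.card (reducibleMaximalOrbitsIn s X) : ℚ) - 3⁻¹ * (if s = 1 ∧ 1 < X then (1 : ℚ) else 0) := by
  classical
  set R := (reducibleMaximalOrbitsIn_finite s X).toFinset with hR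
  have hcardR : (Nat.card (reducibleMaximalOrbitsIn s X) : ℚ) = R.card := by
    rw [hR, Nat.card_eq_card_finite_toFinset (reducibleMaximalOrbitsIn_finite s X)]
  rw [hcardR, ← Finset.sum_filter_add_sum_filter_not R (fun O => O = gl2zOrbit cubeForm)]
  -- the `ℤ³` part
  have hcube : ∑ O ∈ R.filter (fun O => O = gl2zOrbit cubeForm), orbitWeight O = 6⁻¹ * (if s = 1 ∧ 1 < X then (1 : ℚ) else 0) := by
    by_cases hmem : gl2zOrbit cubeForm ∈ reducibleMaximalOrbitsIn s X
    · have hfilter : R.filter (fun O => O = gl2zOrbit cubeForm) = {gl2zOrbit cubeForm} := by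
        ext O
        simp only [Finset.mem_filter, Finset.mem_singleton, hR, Set.Finite.mem_toFinset]
        exact ⟨fun h => h.2, fun h => ⟨h ▸ hmem, h⟩⟩
      rw [hfilter, Finset.sum_singleton, orbitWeight_gl2zOrbit, stabCard, card_stabilizer_cubeForm,
        if_pos ((cubeOrbit_mem_reducible_iff s X).mp hmem)]
      norm_num
    · have hfilter : R.filter (fun O => O = gl2zOrbit cubeForm) = ∅ := by
        ext O
        simp only [Finset.mem_filter, hR, Set.Finite.mem_toFinset, Finset.notMem_empty, iff_false, not_and]
        rintro hO rfl; exact hmem hO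
      rw [hfilter, Finset.sum_empty, if_neg (fun h => hmem ((cubeOrbit_mem_reducible_iff s X).mpr h))]
      norm_num
  -- the `ℤ × 𝓞_F` part: every other orbit has weight `1/2`
  have hrest : ∑ O ∈ R.filter (fun O => ¬ O = gl2zOrbit cubeForm), orbitWeight O =
      2⁻¹ * (R.filter (fun O => ¬ O = gl2zOrbit cubeForm)).card := by
    rw [Finset.card_eq_sum_ones, Nat.cast_sum, Finset.mul_sum]
    refine Finset.sum_congr rfl fun O hO => ?_
    obtain ⟨hOR, hne⟩ := Finset.mem_filter.mp hO
    rw [hR, Set.Finite.mem_toFinset] at hOR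
    rcases orbitWeight_of_mem_reducible s X hOR with ⟨h, -⟩ | ⟨-, h⟩
    · exact absurd h hne
    · rw [h]; norm_num
  -- cardinalities: `#R = #(= ℤ³) + #(≠ ℤ³)`
  have hcard : ((R.filter (fun O => ¬ O = gl2zOrbit cubeForm)).card : ℚ) = R.card - (if s = 1 ∧ 1 < X then (1 : ℚ) else 0) := by
    have h := Finset.card_filter_add_card_filter_not (s := R) (fun O => O = gl2zOrbit cubeForm)
    have hc : ((R.filter (fun O => O = gl2zOrbit cubeForm)).card : ℚ) = (if s = 1 ∧ 1 < X then (1 : ℚ) else 0) := by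
      by_cases hmem : gl2zOrbit cubeForm ∈ reducibleMaximalOrbitsIn s X
      · have hfilter : R.filter (fun O => O = gl2zOrbit cubeForm) = {gl2zOrbit cubeForm} := by
          ext O
          simp only [Finset.mem_filter, Finset.mem_singleton, hR, Set.Finite.mem_toFinset]
          exact ⟨fun h => h.2, fun h => ⟨h ▸ hmem, h⟩⟩
        rw [hfilter, Finset.card_singleton, if_pos ((cubeOrbit_mem_reducible_iff s X).mp hmem)]; norm_num
      · have hfilter : R.filter (fun O => O = gl2zOrbit cubeForm) = ∅ := by
          ext O
          simp only [Finset.mem_filter, hR, Set.Finite.mem_toFinset, Finset.notMem_empty, iff_false, not_and]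
          rintro hO rfl; exact hmem hO
        rw [hfilter, Finset.card_empty, if_neg (fun h => hmem ((cubeOrbit_mem_reducible_iff s X).mpr h))]; norm_num
    have h' : ((R.filter (fun O => O = gl2zOrbit cubeForm)).card : ℚ) + (R.filter (fun O => ¬ O = gl2zOrbit cubeForm)).card = R.card := by
      exact_mod_cast h
    linarith
  rw [hcube, hrest, hcard]
  ring

/-! ### `N^±_{≤3}(X)` -/

/-- **`N^±_{≤3}(X) = #dhOrbitsOne + ⅓ #dhOrbitsThree + ½ #{maximal reducible orbits} − ⅓ [ℤ³ in window]`.** [folklore] -/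
theorem weightedMaximalCount_eq :
    weightedMaximalCount s X = ((dhOrbitsOne s X).card : ℚ) + 3⁻¹ * ((dhOrbitsThree s X).card : ℚ) +
      2⁻¹ * (Nat.card (reducibleMaximalOrbitsIn s X) : ℚ) - 3⁻¹ * (if s = 1 ∧ 1 < X then (1 : ℚ) else 0) := by
  classical
  have hunion : (maximalOrbitsIn_finite s X).toFinset =
      (dhOrbits_finite s (X : ℝ)).toFinset ∪ (reducibleMaximalOrbitsIn_finite s X).toFinset := by
    ext O
    simp only [Finset.mem_union, Set.Finite.mem_toFinset]
    rw [maximalOrbitsIn_eq_union]; rfl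
  have hdisj : Disjoint (dhOrbits_finite s (X : ℝ)).toFinset (reducibleMaximalOrbitsIn_finite s X).toFinset := by
    rw [Finset.disjoint_left]
    intro O h1 h2
    rw [Set.Finite.mem_toFinset] at h1 h2
    exact Set.disjoint_left.mp (disjoint_dhOrbits_reducible s X) h1 h2
  rw [weightedMaximalCount, hunion, Finset.sum_union hdisj, sum_orbitWeight_dhOrbits, sum_orbitWeight_reducible]
  ring

/-- **`N⁻_{≤3}(X) = #dhOrbitsOne⁻ + ⅓ #dhOrbitsThree⁻ + ½ N₂⁻(X)`** — the negative-discriminant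
bookkeeping of BTT Prop. 4.3 (exact; `N₂⁻(X) = #negFundDiscrs X`). [cite: BhargavaTaniguchiThorne2023, Proposition 4.3 with (29) (N₃ = N_{≤3} − ½N₂ + O(#Galois cubic fields))] -/
theorem weightedMaximalCount_neg :
    weightedMaximalCount (-1) X = ((dhOrbitsOne (-1) X).card : ℚ) + 3⁻¹ * ((dhOrbitsThree (-1) X).card : ℚ) +
      2⁻¹ * ((negFundDiscrs X).card : ℚ) := by
  rw [weightedMaximalCount_eq, reducibleMaximalOrbitsIn_neg, card_negReducibleMaximalOrbits, if_neg (by norm_num)]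
  ring

/-- **`N⁺_{≤3}(X) = #dhOrbitsOne⁺ + ⅓ #dhOrbitsThree⁺ + ½ N₂⁺(X) + ⅙ [1 < X]`** — the
positive-discriminant bookkeeping of BTT Prop. 4.3 (exact; the `⅙` is `1/|Aut ℚ³|`). [cite: BhargavaTaniguchiThorne2023, Proposition 4.3 with (29) (N₃ = N_{≤3} − ½N₂ + O(#Galois cubic fields))] -/
theorem weightedMaximalCount_pos :
    weightedMaximalCount 1 X = ((dhOrbitsOne 1 X).card : ℚ) + 3⁻¹ * ((dhOrbitsThree 1 X).card : ℚ) + 2⁻¹ * ((posFundDiscrs X).card : ℚ) +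
      6⁻¹ * (if 1 < X then (1 : ℚ) else 0) := by
  rw [weightedMaximalCount_eq, reducibleMaximalOrbitsIn_pos, card_posReducibleMaximalOrbits]
  push_cast
  simp only [true_and]
  split_ifs <;> ring

end Literature.NumberTheory.CubicFields
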